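import Summits.ABC.IUTFork.Cor312RamifiedEOrbitHull
import Summits.ABC.IUTFork.Cor312PinnedSetting
import Summits.ABC.IUTFork.Thm311ToCor312
import HarnessLib

/-!
# [IUTchIII] Cor. 3.12 — the RAMIFIED SHEAR bed at GENERAL ramification index `e`, IV: the setting RAM_e(p, m),
# its two printed quantities, and the THRESHOLD in `(e, m)` (typed Corollary: YES for `m ≤ e − 1`, NO for `3m > 5(e − 1)`)

Record-only file (D-0012; MODEL DATA `ramDataE`/`ramSituationE`/`ramSettingE`/`hullK`, then proofs; no `Prop` fact, nothing asserted
about print) of the abc-iut cell, IUT REPAIR BRANCH (rung LADDER-ABC:A2.RP), seat abc-iut-rp-m1 (gen 4; class (ii) = Mochizuki's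
replies). TAKES NO SIDE on [IUTchIII] Cor. 3.12. Sequel to `Cor312RamifiedEShells` / `…EPolydiscs` / `…EOrbitHull` (rank-`e` shells
for `K = ℚ_p(π)`, `π^e = p`, Ism = `GL_e(ℤ_(p))` — the Dupuy–Hilado reading [cite: DupuyHilado2025, §4.9]; polydiscs `box k`,
`μ(box k) = −(k/e)·log p`; `hull_orbitUnion`: the (Ind1),(Ind2)-orbit of `box k` at label `j` has hull `box (e·⌈(k − (j+1)(e−1))/e⌉)`).
It generalises the seat's gen-3 `Cor312RamifiedSetting` (`e = 2`: typed Corollary ⟺ `m = 1`) — row RP-M47 of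
HOME/plan/repair/CANDIDATES.tsv ([Rpt2018] (VUC3) p. 14 l. 11–32, (†ΘCR) p. 16 l. 58–66, (SSIdFs) p. 16 l. 68–70).

THE SETTING RAM_e(p, m) (`m = v_π(q) ≥ 1`; honest object side `pinSig` of abc-iut-w4-d101: objects are exponents, the lgp-object of
exponent `k` at label `j` has Kummer image the Θ-box `box (m·k·j²)` — `q^{k·j²}` has `π`-adic valuation `m·k·j²` —, the `△`-object of
exponent `k` the q-box `box (m·k)`; column `0`; frame the polydiscs; log-volume of a region := `μ` of its hull).
KERNEL FACTS (one place, `l⋇ = 2`, labels `j = 1, 2`; `hullK e m j := e·hullIdx e (m·j²) ((j+1)(e−1))` the box index of `ⁿ˒°𝒰_j`,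
`hullK_bounds`: `m·j² − (j+1)(e−1) ≤ hullK ≤ m·j² − j(e−1)`):
* `ramSettingE_thetaHull` — **`ⁿ˒°𝒰_j = box (hullK e m j)`**; `ramE_ind_not_eliminable` — STRICT, indeterminacy-borne inflation at every
  label `j ≥ 1` once `e ≥ 2` (the Θ-box is itself a hull-set), by between `j` and `j+1` log-differents `(e−1)/e·log p`, independent
  of `m`;
* `ramSettingE_negLogQ` `−|log(q)| = −(m/e)·log p`; `ramSettingE_negLogTheta` `−|log(Θ)| = −((hullK₁ + hullK₂)/(2e))·log p`;
* **`ramSettingE_statement_iff` — the typed Corollary 3.12 HOLDS iff `hullK₁ + hullK₂ ≤ 2m`**, whence the THRESHOLD: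
  **`ramSettingE_statement_of_le` — it HOLDS whenever `m ≤ e − 1`** (`|log(q)|` at most one log-different: the different-dominated,
  SHALLOW regime), **`ramSettingE_not_statement_of_lt` — it FAILS whenever `3m > 5(e − 1)`** (the height-dominated, DEEP regime: every
  such datum is a countermodel); in between it depends on residues mod `e` (`e = 2` recovers gen 3's «⟺ `m = 1`», `e = 1` — unramified,
  Ism isometric — never: sequel `Repair.CandMochizuki7RamE`);
* **the hull INCLUSION (licence, (xi-f)) `q-box ⊆ ⁿ˒°𝒰_j` HOLDS at both labels whenever `3m ≤ 2(e − 1)`** (`ramSettingE_licence_of_le`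
  — the first bed of this lineage on which abc-iut-c312-1's `Thm311ToCor312.Licence` is TRUE: the log-different swamps `|log(q)|`) and
  FAILS at label 2 whenever `m ≥ e` (`ramSettingE_not_licence_of_le`);
* `ramSettingE_bridgeHyps`, `ramSettingE_absLogQPos` (the packaged deep / shallow profiles are in the sequel `Repair.CandMochizuki7RamE`).
READING for row RP-M47 / the (†ΘCR)–(SSInd) exchange ([Rpt2018] p. 16 l. 58–66 vs [SS2018] §2.2), neutral: on the one family of typed
beds where the author's «(Ind1), (Ind2) cannot be eliminated» is TRUE of the hull, un-rigidifying Ism to all lattice automorphisms buys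
an `m`-independent inflation of LOG-DIFFERENT size (`≤ (j+1)(e−1)/e·log p` at label `j`), so the typed inequality holds exactly in the
regime `|log(q)| ≲ (5/3)·(e−1)/e·log p` — a bound of the height term by the different term, the SHAPE of [IUTchIV] Thm. 1.10 read as a
CONSTRAINT ON THE DATUM — and fails at every deeper datum. Interface-level toy over `toyIndex`; NOT a model of initial Θ-data;
Dupuy–Hilado's Ism, not print's; nothing here bears on which reading of Thm. 3.11 is right. [claim: Mochizuki2012, status: disputed]
[cite: ScholzeStix2018, §2.2 pp. 9–10]
-/

noncomputable section

namespace Summit.ABC.IUTFork.Cor312Vol.RamifiedEWitness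

open Set Thm311 Cor312 Cor312.Checks Cor312.IdentifiedNonVacuity NaiveWitness PinnedWitness Literature.IUT.LogThetaLattice

variable (p e : ℕ)

/-! ## 1. The situation: data (a)(b)(c) over the ramified shells of index `e` -/

/-- **The data (a)(b)(c) of every vertical line** of the ramified bed of index `e`: integral structures the packet log-shell lattices
`𝕀`, admissible regions the bounded sets admitting a hull, log-volume of a region := `μ` of its holomorphic hull; no splitting-monoid /
number-field data are read by Cor. 3.12's two quantities (left empty). [claim: Mochizuki2012, status: disputed] -/
def ramDataE [Fact p.Prime] : MRData (ramShellsE p e) where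
  shellPk := fun j vQ => {x | Integral p e j vQ x}
  shellSub := fun j v => {x | Integral p e j (toyIndex.over v) x}
  Adm := fun j vQ A => (rFrame p e j vQ).IsBounded A ∧ (rFrame p e j vQ).HasHull A
  logvol := fun j vQ A => rVol p e j vQ ((rFrame p e j vQ).hull A)
  Ψ := fun _ _ => ∅
  act := fun _ _ _ => 0
  Mmod := fun _ => ∅

/-- One global object of degree `0` whose region is everything (context only). [folklore] -/
def ramDegreesE (j : toyIndex.LabelStar) : GlobalDegrees (ramShellsE p e) j where
  ObjMOD := Unit
  Objmod := Unit
  natIso := Equiv.refl Unit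
  deg := fun _ => 0
  region := fun _ _ => Set.univ

/-- **The SITUATION of the ramified bed of index `e`**: the shells `ramShellsE p e` with the same data on every vertical line.
[claim: Mochizuki2012, status: disputed] -/
def ramSituationE [Fact p.Prime] : Situation toyIndex where
  L := ramShellsE p e
  D := fun _ => ramDataE p e
  G := fun _ j => ramDegreesE p e j

/-! ## 2. The setting RAM_e(p, m) -/

/-- **The Cor. 3.12 SETTING RAM_e(p, m)** (`m = v_π(q)`): column `0`; honest object side `pinSig` (objects = exponents, `q := gen`);
frame the 𝒪_L-polydiscs; GLUE READING THE OBJECTS through the `π`-adic valuation of the theta values: lgp-object of exponent `k` at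
label `j` ↦ `box (m·k·j²)`, `△`-object of exponent `k` ↦ `box (m·k)` (`box 0` at the unread zero label).
[claim: Mochizuki2012, status: disputed] -/
def ramSettingE [Fact p.Prime] [NeZero e] (m : ℕ) : Setting (ramSituationE p e) where
  n := 0
  HT := ℤ × ℤ
  LogLink := fun _ _ => Unit
  IsFull := fun _ => True
  lattice :=
    { theater := fun n m => (n, m)
      distinct := fun p q h => by simpa using h
      logLink := fun _ _ => ()
      logLink_full := fun _ _ => trivial }
  Frd := Unit
  IsoF := fun _ _ => Unit
  Ob := fun _ => ℤ
  realify := id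
  Strip := Unit
  IsoS := fun _ _ => Unit
  M := fun _ _ => ExpMonoid
  sig := pinSig
  split := { Msplit := fun _ _ => ⊤, exists_gen := fun _ _ => ⟨⟨gen, trivial⟩, top_gen_isGenerator⟩ }
  ObΔ := ℤ
  N := fun _ _ => ExpMonoid
  qData :=
    { q := fun _ _ => gen
      q_gen := fun _ _ => gen_isGenerator
      objOf := fun x => (expOf (x () (Set.mem_univ ())) : ℤ) }
  frame := fun j vQ => rFrame p e j vQ
  hul_adm := fun j vQ _ hH => by obtain ⟨k, rfl⟩ := hH; exact rFrame_bounded_hasHull j vQ k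
  thetaRegionOf := fun _ k j vQ => box p e j vQ ((m : ℤ) * k * jsq j)
  qRegionOf := fun k j vQ => box p e j vQ (if j = 0 then 0 else (m : ℤ) * k)
  qRegion_mem := fun j vQ => ⟨_, rfl⟩
  qSupport_finite := fun _ => Set.toFinite _

/-- **The box index of the holomorphic hull `ⁿ˒°𝒰_j`** in RAM_e(p, m): `hullK e m j := e·⌈(m·j² − (j+1)(e−1))/e⌉`. [folklore] -/
def hullK (m : ℕ) (j : toyIndex.Label) : ℤ := e * hullIdx e ((m : ℤ) * jsq j) (wmax e j)

variable {e} in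
/-- **`m·j² − (j+1)(e−1) ≤ hullK e m j ≤ m·j² − (j+1)(e−1) + (e−1)`** (`e ≥ 1`). [folklore] -/
theorem hullK_bounds (he : 1 ≤ e) (m : ℕ) (j : toyIndex.Label) :
    (m : ℤ) * jsq j - wmax e j ≤ hullK e m j ∧ hullK e m j ≤ (m : ℤ) * jsq j - wmax e j + ((e : ℤ) - 1) :=
  hullIdx_bounds he _ _

/-- The two labels of `𝔽_l^⋇`: `j² = 1, 4` and `wmax = 2(e−1), 3(e−1)`. [folklore] -/
theorem labels_data :
    jsq (Setting.labelSucc ((0 : Fin 2) : Fin toyIndex.lstar) : toyIndex.Label) = 1 ∧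
      jsq (Setting.labelSucc ((1 : Fin 2) : Fin toyIndex.lstar) : toyIndex.Label) = 4 ∧
      wmax e (Setting.labelSucc ((0 : Fin 2) : Fin toyIndex.lstar) : toyIndex.Label) = 2 * ((e : ℤ) - 1) ∧
      wmax e (Setting.labelSucc ((1 : Fin 2) : Fin toyIndex.lstar) : toyIndex.Label) = 3 * ((e : ℤ) - 1) := by
  refine ⟨rfl, rfl, ?_, ?_⟩
  · show (((1 : ℕ) + 1 : ℕ) : ℤ) * ((e : ℤ) - 1) = _
    norm_num
  · show (((2 : ℕ) + 1 : ℕ) : ℤ) * ((e : ℤ) - 1) = _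
    norm_num

variable {e} in
/-- **The hull indices at the two labels**: `hullK₁ ∈ [m − 2(e−1), m − (e−1)]`, `hullK₂ ∈ [4m − 3(e−1), 4m − 2(e−1)]` (`e ≥ 1`). [folklore] -/
theorem hullK_labels_bounds (he : 1 ≤ e) (m : ℕ) :
    ((m : ℤ) - 2 * ((e : ℤ) - 1) ≤ hullK e m (Setting.labelSucc ((0 : Fin 2) : Fin toyIndex.lstar)) ∧
        hullK e m (Setting.labelSucc ((0 : Fin 2) : Fin toyIndex.lstar)) ≤ (m : ℤ) - ((e : ℤ) - 1)) ∧
      (4 * (m : ℤ) - 3 * ((e : ℤ) - 1) ≤ hullK e m (Setting.labelSucc ((1 : Fin 2) : Fin toyIndex.lstar)) ∧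
        hullK e m (Setting.labelSucc ((1 : Fin 2) : Fin toyIndex.lstar)) ≤ 4 * (m : ℤ) - 2 * ((e : ℤ) - 1)) := by
  have h0 := hullK_bounds he m (Setting.labelSucc ((0 : Fin 2) : Fin toyIndex.lstar))
  have h1 := hullK_bounds he m (Setting.labelSucc ((1 : Fin 2) : Fin toyIndex.lstar))
  obtain ⟨hj0, hj1, hw0, hw1⟩ := labels_data e
  rw [hj0, hw0] at h0
  rw [hj1, hw1] at h1
  constructor <;> constructor <;> omega

variable [hp : Fact p.Prime] [NeZero e] (m : ℕ)

/-- The Θ-pilot object is the lgp-object of exponent `1`. [folklore] -/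
theorem ramSettingE_thetaPilot : (ramSettingE p e m).thetaPilot = (1 : ℤ) :=
  congrArg (Nat.cast : ℕ → ℤ)
    (expOf_eq_one_of_isGenerator_top (Classical.choose_spec ((ramSettingE p e m).split.exists_gen () (Set.mem_univ ()))))

/-- The q-pilot object is the `△`-object of exponent `1`. [folklore] -/
theorem ramSettingE_qPilot : (ramSettingE p e m).qPilot = (1 : ℤ) := rfl

/-- The `(n,m')`-Kummer image of the Θ-pilot object at label `j` is the Θ-box `box (m·j²)`. [folklore] -/
theorem ramSettingE_thetaRegion (m' : ℤ) (j : toyIndex.Label) (vQ : toyIndex.VQ) :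
    (ramSettingE p e m).thetaRegion m' j vQ = box p e j vQ ((m : ℤ) * jsq j) := by
  unfold Setting.thetaRegion
  rw [ramSettingE_thetaPilot]
  show box p e j vQ ((m : ℤ) * 1 * jsq j) = _
  rw [mul_one]

/-- The (Ind3)-enlarged region is `box (m·j²)`. [folklore] -/
theorem ramSettingE_thetaRegion3 (j : toyIndex.Label) (vQ : toyIndex.VQ) :
    (ramSettingE p e m).thetaRegion3 j vQ = box p e j vQ ((m : ℤ) * jsq j) := by
  show (⋃ m' : ℤ, (ramSettingE p e m).thetaRegion m' j vQ) = _
  simp_rw [ramSettingE_thetaRegion]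
  exact Set.iUnion_const _

/-- At a nonzero label the image of the q-pilot object is the q-box `box m`. [folklore] -/
theorem ramSettingE_qRegion_of_ne_zero {j : toyIndex.Label} (hj : j ≠ 0) (vQ : toyIndex.VQ) :
    (ramSettingE p e m).qRegion j vQ = box p e j vQ m := by
  show (ramSettingE p e m).qRegionOf (ramSettingE p e m).qPilot j vQ = _
  rw [ramSettingE_qPilot]
  show box p e j vQ (if j = 0 then 0 else (m : ℤ) * 1) = _
  rw [if_neg hj, mul_one]

/-- The union of the possible images of the Θ-pilot is the (Ind1),(Ind2)-orbit union of the Θ-box. [folklore] -/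
theorem ramSettingE_sUnion_possibleImages (j : toyIndex.Label) (vQ : toyIndex.VQ) :
    (⋃₀ (ramSettingE p e m).possibleImages j vQ : Set ((ramSituationE p e).L.Packet j vQ)) =
      orbitUnion p e j vQ ((m : ℤ) * jsq j) := by
  unfold orbitUnion Setting.possibleImages
  rw [ramSettingE_thetaRegion3]
  rfl

/-- **`ⁿ˒°𝒰_{j,v_ℚ} = box (hullK e m j) = box (e·⌈(m·j² − (j+1)(e−1))/e⌉)`**: the EXACT holomorphic hull in RAM_e(p, m).
[claim: Mochizuki2012, status: disputed] -/
theorem ramSettingE_thetaHull (j : toyIndex.Label) (vQ : toyIndex.VQ) :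
    (ramSettingE p e m).thetaHull j vQ = box p e j vQ (hullK e m j) :=
  (congrArg (rFrame p e j vQ).hull (ramSettingE_sUnion_possibleImages p e m j vQ)).trans (hull_orbitUnion j vQ _)

/-- **(Ind1),(Ind2) are NOT ELIMINABLE in RAM_e(p, m) once `e ≥ 2`**: the Θ-box is itself a hull-set, yet `ⁿ˒°𝒰` is strictly larger at
every label `j ≥ 1` — the inflation (`≥ j(e−1)` `π`-steps) is borne by the indeterminacies, not by the frame.
[claim: Mochizuki2012, status: disputed] -/
theorem ramE_ind_not_eliminable (he : 2 ≤ e) {j : toyIndex.Label} (hj : j ≠ 0) (vQ : toyIndex.VQ) :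
    (rFrame p e j vQ).hull ((ramSettingE p e m).thetaRegion3 j vQ) = (ramSettingE p e m).thetaRegion3 j vQ ∧
      (ramSettingE p e m).thetaRegion3 j vQ ⊂ (ramSettingE p e m).thetaHull j vQ := by
  rw [ramSettingE_thetaRegion3, ramSettingE_thetaHull, rFrame_hull_box]
  have hb := hullK_bounds (e := e) (by omega) m j
  have hj1 : (1 : ℤ) ≤ (j : ℕ) := by
    have : (j : ℕ) ≠ 0 := fun h0 => hj (Fin.ext h0)
    omega
  have hw : ((e : ℤ) - 1) + 1 ≤ wmax e j := by
    unfold wmax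
    have h2 : (2 : ℤ) * ((e : ℤ) - 1) ≤ (((j : ℕ) + 1 : ℕ) : ℤ) * ((e : ℤ) - 1) :=
      mul_le_mul_of_nonneg_right (by push_cast; omega) (by omega)
    have h3 : (2 : ℤ) ≤ e := by exact_mod_cast he
    nlinarith
  refine ⟨rfl, box_mono j vQ (by omega), fun h => ?_⟩
  have h1 := (box_subset_iff j vQ _ _).1 h
  omega

/-- Every union of possible images admits its hull. [folklore] -/
theorem ramSettingE_hullDefined (j : toyIndex.Label) (vQ : toyIndex.VQ) : (ramSettingE p e m).HullDefined j vQ := by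
  have h := orbitUnion_bounded_hasHull (p := p) (e := e) j vQ ((m : ℤ) * jsq j)
  rw [← ramSettingE_sUnion_possibleImages] at h
  exact h

/-- The local Θ-term at `(j, v_ℚ)` is `μ(box (hullK e m j)) = −(hullK/e)·log p`. [folklore] -/
theorem ramSettingE_thetaLocal (j : toyIndex.Label) (vQ : toyIndex.VQ) :
    (ramSettingE p e m).thetaLocal j vQ = ((-((hullK e m j : ℝ) / e) * Real.log p : ℝ) : WithTop ℝ) := by
  unfold Setting.thetaLocal
  rw [if_pos (ramSettingE_hullDefined p e m j vQ)]
  show ((rVol p e j vQ ((rFrame p e j vQ).hull ((ramSettingE p e m).thetaHull j vQ)) : ℝ) : WithTop ℝ) = _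
  rw [ramSettingE_thetaHull, rFrame_hull_box, rVol_box]

/-- The local q-term at a label of `𝔽_l^⋇` is `μ(box m) = −(m/e)·log p`. [folklore] -/
theorem ramSettingE_qLocal (i : Fin toyIndex.lstar) (vQ : toyIndex.VQ) :
    (ramSettingE p e m).qLocal (Setting.labelSucc i) vQ = -((m : ℝ) / e) * Real.log p := by
  show rVol p e _ vQ ((rFrame p e _ vQ).hull ((ramSettingE p e m).qRegion (Setting.labelSucc i) vQ)) = _
  rw [ramSettingE_qRegion_of_ne_zero p e m (Setting.labelSucc_ne_zero i), rFrame_hull_box, rVol_box]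
  push_cast
  ring

/-- "`−|log(Θ)|` is finite". [folklore] -/
theorem ramSettingE_thetaFinite : (ramSettingE p e m).ThetaFinite :=
  ⟨fun i vQ => by rw [ramSettingE_thetaLocal]; exact WithTop.coe_ne_top, fun _ => Set.toFinite _⟩

/-- **`−|log(q)| = −(m/e)·log p`.** [folklore] -/
theorem ramSettingE_negLogQ : (ramSettingE p e m).negLogQ = -((m : ℝ) / e) * Real.log p := by
  unfold Setting.negLogQ
  have h : (fun i : Fin toyIndex.lstar => ∑ᶠ vQ : toyIndex.VQ, (ramSettingE p e m).qLocal (Setting.labelSucc i) vQ) =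
      fun _ => -((m : ℝ) / e) * Real.log p := by
    funext i
    rw [finsum_unique]
    exact ramSettingE_qLocal p e m i _
  rw [h]
  exact processionNormalized_const (by decide) _

/-- **`−|log(Θ)| = −((hullK₁ + hullK₂)/(2e))·log p`** (`(μ(ⁿ˒°𝒰_1) + μ(ⁿ˒°𝒰_2))/2`). [folklore] -/
theorem ramSettingE_negLogTheta :
    (ramSettingE p e m).negLogTheta =
      ((-(((hullK e m (Setting.labelSucc ((0 : Fin 2) : Fin toyIndex.lstar)) +
          hullK e m (Setting.labelSucc ((1 : Fin 2) : Fin toyIndex.lstar)) : ℤ) : ℝ) / (2 * e)) * Real.log p : ℝ) : WithTop ℝ) := by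
  unfold Setting.negLogTheta
  rw [if_pos (ramSettingE_thetaFinite p e m)]
  have h : (fun i : Fin toyIndex.lstar =>
      ∑ᶠ vQ : toyIndex.VQ, ((ramSettingE p e m).thetaLocal (Setting.labelSucc i) vQ).untopD 0) =
      fun i => -((hullK e m (Setting.labelSucc i) : ℝ) / e) * Real.log p := by
    funext i
    rw [finsum_unique, ramSettingE_thetaLocal, WithTop.untopD_coe]
  rw [h]
  congr 1
  show (∑ i : Fin 2, -((hullK e m (Setting.labelSucc i) : ℝ) / e) * Real.log p) / ((2 : ℕ) : ℝ) = _
  rw [Fin.sum_univ_two]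
  have he : (e : ℝ) ≠ 0 := Nat.cast_ne_zero.mpr (NeZero.ne e)
  push_cast
  field_simp
  ring

/-- **The typed Corollary 3.12 holds in RAM_e(p, m) IFF `hullK₁ + hullK₂ ≤ 2m`** (`−|log(q)| ≤ −|log(Θ)|` reads
`(hullK₁ + hullK₂)/(2e) ≤ m/e`). [claim: Mochizuki2012, status: disputed] -/
theorem ramSettingE_statement_iff :
    (ramSettingE p e m).Statement ↔
      hullK e m (Setting.labelSucc ((0 : Fin 2) : Fin toyIndex.lstar)) +
          hullK e m (Setting.labelSucc ((1 : Fin 2) : Fin toyIndex.lstar)) ≤ 2 * (m : ℤ) := by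
  unfold Setting.Statement
  rw [ramSettingE_negLogQ, ramSettingE_negLogTheta, WithTop.coe_le_coe]
  have hL := log_p_pos p
  have he : (0 : ℝ) < e := by exact_mod_cast Nat.pos_of_ne_zero (NeZero.ne e)
  set K : ℤ := hullK e m (Setting.labelSucc ((0 : Fin 2) : Fin toyIndex.lstar)) +
    hullK e m (Setting.labelSucc ((1 : Fin 2) : Fin toyIndex.lstar)) with hK
  constructor
  · rintro ⟨-, h⟩
    have h' : ((K : ℝ) / (2 * e)) * Real.log p ≤ ((m : ℝ) / e) * Real.log p := by linarith
    have h'' := le_of_mul_le_mul_right h' hL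
    rw [div_le_div_iff₀ (by positivity) he] at h''
    have : ((K : ℤ) : ℝ) ≤ 2 * (m : ℝ) := by nlinarith
    exact_mod_cast this
  · intro h
    refine ⟨WithTop.coe_ne_top, ?_⟩
    have h1 : ((K : ℤ) : ℝ) ≤ 2 * (m : ℝ) := by exact_mod_cast h
    have h2 : (K : ℝ) / (2 * e) ≤ (m : ℝ) / e := by
      rw [div_le_div_iff₀ (by positivity) he]
      nlinarith
    nlinarith

/-- **THRESHOLD, shallow side: the typed Corollary HOLDS whenever `m ≤ e − 1`** (`|log(q)| = (m/e)·log p` at most one log-different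
`(e−1)/e·log p`): `hullK₁ + hullK₂ ≤ (m − (e−1)) + (4m − 2(e−1)) = 5m − 3(e−1) ≤ 2m`. [claim: Mochizuki2012, status: disputed] -/
theorem ramSettingE_statement_of_le (h : m + 1 ≤ e) : (ramSettingE p e m).Statement := by
  rw [ramSettingE_statement_iff]
  have hb := hullK_labels_bounds (e := e) (by omega) m
  have h' : (m : ℤ) + 1 ≤ e := by exact_mod_cast h
  omega

/-- **THRESHOLD, deep side: the typed Corollary FAILS whenever `3m > 5(e − 1)`** — every such datum is a countermodel:
`hullK₁ + hullK₂ ≥ (m − 2(e−1)) + (4m − 3(e−1)) = 5m − 5(e−1) > 2m`. [claim: Mochizuki2012, status: disputed] -/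
theorem ramSettingE_not_statement_of_lt (h : 5 * ((e : ℤ) - 1) < 3 * (m : ℤ)) : ¬ (ramSettingE p e m).Statement := by
  rw [ramSettingE_statement_iff]
  have hb := hullK_labels_bounds (e := e) (NeZero.one_le) m
  omega

/-- **`|log(q)| > 0`** for `m ≥ 1`. [folklore] -/
theorem ramSettingE_absLogQPos (hm : 1 ≤ m) : (ramSettingE p e m).AbsLogQPos := by
  show (ramSettingE p e m).negLogQ < 0
  rw [ramSettingE_negLogQ]
  have hL := log_p_pos p
  have he : (0 : ℝ) < e := by exact_mod_cast Nat.pos_of_ne_zero (NeZero.ne e)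
  have hm' : (0 : ℝ) < m := by exact_mod_cast hm
  have : (0 : ℝ) < (m : ℝ) / e := div_pos hm' he
  nlinarith

/-- **The hull INCLUSION (licence, (xi-f)) HOLDS in RAM_e(p, m) whenever `3m ≤ 2(e − 1)`**: at label 1 `box m ⊆ box hullK₁` always
(`hullK₁ ≤ m − (e−1)`), at label 2 `hullK₂ ≤ 4m − 2(e−1) ≤ m`. [claim: Mochizuki2012, status: disputed] -/
theorem ramSettingE_licence_of_le (h : 3 * (m : ℤ) ≤ 2 * ((e : ℤ) - 1)) : Thm311ToCor312.Licence (ramSettingE p e m) := by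
  intro i vQ
  rw [ramSettingE_qRegion_of_ne_zero p e m (Setting.labelSucc_ne_zero i), ramSettingE_thetaHull]
  refine box_mono _ vQ ?_
  have hb := hullK_labels_bounds (e := e) (NeZero.one_le) m
  fin_cases i
  · exact le_trans hb.1.2 (by omega)
  · exact le_trans hb.2.2 (by omega)

/-- **The hull INCLUSION FAILS at label 2 whenever `m ≥ e`** (`hullK₂ ≥ 4m − 3(e−1) > m`). [claim: Mochizuki2012, status: disputed] -/
theorem ramSettingE_not_licence_of_le (h : (e : ℤ) ≤ m) : ¬ Thm311ToCor312.Licence (ramSettingE p e m) := fun hl => by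
  have h2 := hl ((1 : Fin 2) : Fin toyIndex.lstar) ()
  rw [ramSettingE_qRegion_of_ne_zero p e m (Setting.labelSucc_ne_zero _), ramSettingE_thetaHull] at h2
  have h3 := (box_subset_iff (p := p) (e := e) _ _ _ _).1 h2
  have hb := hullK_labels_bounds (e := e) (NeZero.one_le) m
  omega

/-- **All bridge hypotheses hold in RAM_e(p, m)** (monotone hull-volume; possible images bounded with a nonzero element; nonempty
hull-sets and Θ-regions; `ThetaFinite`). [folklore] -/
theorem ramSettingE_bridgeHyps : BridgeHyps (ramSettingE p e m) where
  mono := by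
    intro i vQ A B hA hB hAB
    obtain ⟨kA, hkA⟩ := (rFrame p e (Setting.labelSucc i) vQ).hull_mem_of_hasHull hA.1 hA.2
    obtain ⟨kB, hkB⟩ := (rFrame p e (Setting.labelSucc i) vQ).hull_mem_of_hasHull hB.1 hB.2
    have hsub : box p e (Setting.labelSucc i) vQ kA ⊆ box p e (Setting.labelSucc i) vQ kB := by
      rw [hkA, hkB]; exact (rFrame p e (Setting.labelSucc i) vQ).hull_mono hAB
    show rVol p e (Setting.labelSucc i) vQ ((rFrame p e (Setting.labelSucc i) vQ).hull A) ≤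
      rVol p e (Setting.labelSucc i) vQ ((rFrame p e (Setting.labelSucc i) vQ).hull B)
    rw [← hkA, ← hkB]
    exact rVol_mono p e hsub
  image_adm := by
    rintro i vQ U ⟨Φ, hΦ, rfl⟩
    rw [ramSettingE_thetaRegion3]
    show (rFrame p e (Setting.labelSucc i) vQ).IsBounded
        (Φ (Setting.labelSucc i) vQ '' box p e (Setting.labelSucc i) vQ ((m : ℤ) * jsq (Setting.labelSucc i))) ∧
      (rFrame p e (Setting.labelSucc i) vQ).HasHull
        (Φ (Setting.labelSucc i) vQ '' box p e (Setting.labelSucc i) vQ ((m : ℤ) * jsq (Setting.labelSucc i)))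
    refine ⟨?_, ?_⟩
    · have hU : (Φ (Setting.labelSucc i) vQ '' box p e (Setting.labelSucc i) vQ ((m : ℤ) * jsq (Setting.labelSucc i))) ∈
          {U | ∃ Ψ ∈ indG p e, U = Ψ (Setting.labelSucc i) vQ ''
            box p e (Setting.labelSucc i) vQ ((m : ℤ) * jsq (Setting.labelSucc i))} :=
        ⟨Φ, hΦ, rfl⟩
      exact ⟨_, (Set.subset_sUnion_of_mem hU).trans (orbitUnion_subset (NeZero.one_le) (Setting.labelSucc i) vQ _)⟩
    · obtain ⟨-, x, hx, hx0⟩ :=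
        rFrame_bounded_hasHull (p := p) (e := e) (Setting.labelSucc i) vQ ((m : ℤ) * jsq (Setting.labelSucc i))
      exact ⟨Φ _ vQ x, Set.mem_image_of_mem _ hx, fun h0 => hx0 ((Φ _ vQ).map_eq_zero_iff.1 h0)⟩
  image_fin := fun _ => Set.toFinite _
  hul_nonempty := fun j vQ H hH => by obtain ⟨k, rfl⟩ := hH; exact ⟨0, zero_mem_box j vQ k⟩
  theta_nonempty := fun i vQ => by rw [ramSettingE_thetaRegion3]; exact ⟨0, zero_mem_box _ vQ _⟩
  finite := ramSettingE_thetaFinite p e m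

end Summit.ABC.IUTFork.Cor312Vol.RamifiedEWitness

end
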